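import Summits.BirchSwinnertonDyer.BirchSwinnertonDyer.Theorems.EisensteinDepletionAtTwoStarSymbCRefFifteen
import HarnessLib

/-!
# Route `EisensteinDepletionAtTwo`, crux E1M `DepletedLambdaLawAtTwoMod` (stmt-BirchSwinnertonDyer-20341), line `star`:
# (★-SymbC) holds for EVERY elliptic curve of conductor `15` — the level-15 case of the research stub, by name

Cell `bsd-rank2` (HOME run/shared/lean/pub/bsd-rank2/), lead `bsd-rank2-star-p1` GEN 3 (helper `--supports` the crux item;
skeleton `Cruxes/DepletedLambdaLawAtTwoMod/Lines/star.lean` v3.6, stub `stub_starSymbFifteen`). eng GEN 10's theorem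
`sameOnC_refFifteen` (`…StarSymbCRefFifteen.lean`, p572647) proves the symbol half (★-SymbC) of the mod-2 identity (★) for the
newforms of the reference curve `15A8 = [1,1,1,0,0]`. Its proof uses that curve only through two facts valid for EVERY
normalised newform `h ∈ S₂(Γ₀(15))` with rational coefficients: the exact descent law
`[a/c]⁺_h − [0]⁺_h = s·(descent c d).1/2` (`Rank2.LevelFifteen.ratPlusSymbol_sub_zero_eq_descent`) and the Eisenstein period law
`(15/4)·φ ≡ n₁ + ψ (mod 4)` (`law_pair`); the value `[0]⁺ = −s/8` specific to `15A8` cancels in the cusp DIFFERENCES. Hence: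

* `sameOnC_fifteen` — for every normalised rational newform `h` of level `15` and `β = (3,1)`:
  `SameOnCModTwo (plusCuspDiff h) (stabEisCuspDiff 15 β)` unfolded (`g = s = ±1`, `g' = 8/15`, odd at `(m,a) = (3,5)`);
* `starSymbC_of_conductorNorm_eq_fifteen` — for EVERY elliptic `W/ℚ` with `N_W = 15` and every newform `f` of `W` (any level
  `N`; `N = 15` by the squarefree case of Carayol, `IsNewformOf.level_eq_conductorNorm_of_squarefree`), the body of the
  registered stub `StarSymbC` holds — no habitat hypothesis is needed at this level (the class `15a` is the only one).

This closes the v3.6 stub `stub_starSymbFifteen` (the conductor-15 case, where the plus functional has 2-adic depth 1 on the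
C-cycles — eng GEN 10 law4 census: the ONLY such habitat class with N ≤ 2000) BY NAME. THEOREMS ONLY; no `sorry`; standard axioms.
PARTITION: none — r_an ≥ 2, summit axis S0; TWIN (D-0056): n/a. B1 honesty: finite Manin-symbol / Dedekind-sum arithmetic at
level 15; nothing reads an analytic rank; no S0 motion; (★-SymbC) for a general habitat curve, (★), E1M and BSD are NOT proved.

References: B. Mazur, J. Tate, J. Teitelbaum, *Invent. Math.* 84 (1986) §I.8, §I.10 [MazurTateTeitelbaum1986Invent];
G. Stevens, *Arithmetic on Modular Curves*, Progr. Math. 20 (1982) §2.4–2.5 [Stevens1982]; Ju. I. Manin, *Izv. AN SSSR* 36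
(1972) Thm. 1.6 [Manin1972]; A. O. L. Atkin, J. Lehner, *Math. Ann.* 185 (1970) Thm. 3 [AtkinLehner1970];
J. E. Cremona, *Algorithms for modular elliptic curves* (1997) §2.8, Table 1 (15A) [CremonaAlgorithms1997].
-/

set_option linter.dupNamespace false

noncomputable section

open scoped MatrixGroups ModularForm

open CongruenceSubgroup Matrix.SpecialLinearGroup ModularGroup
open Literature.NumberTheory.ModularForms Literature.NumberTheory.EllipticCurves
  Literature.NumberTheory.EllipticCurves.ModularForms
open Summit.BirchSwinnertonDyer.Rank2.LevelFifteen

namespace Summit.BirchSwinnertonDyer.BirchSwinnertonDyer.Theorems.DepletionAtTwo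

/-- **(★-SymbC) AT LEVEL 15 for every rational newform.** For every normalised newform `h ∈ S₂(Γ₀(15))` with rational
Fourier coefficients and `β = (β₃, β₅) = (3, 1)`, with `g = s = ±1` (the sign of `re E₁(h)`) and `g' = 8/15`: on
`C = {(m,a) : m ≥ 3, a ≡ 1 (4), 1 < a < 2^m}`, `[a/2^m]⁺_h − [1/2^m]⁺_h = n·g`, `φ_β(γ_{a,2^m}) − φ_β(γ_{1,2^m}) = n'·g'` with
`n ≡ n' (mod 2)`, and `n` is odd at `(3, 5)`. (eng GEN 10's `sameOnC_refFifteen` with the `15A8`-specific value of `[0]⁺`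
removed: only differences of plus symbols enter.)
[cite: MazurTateTeitelbaum1986Invent, §I.8 and §I.10 (10.1)] [cite: Stevens1982, §2.5 (PDF p. 38)] [cite: Manin1972, Thm. 1.6] -/
theorem sameOnC_fifteen (β : ℕ → ℕ) (h3 : β 3 = 3) (h5 : β 5 = 1)
    (h : CuspForm (Gamma0 15) 2) (hf : IsNewform0 h) (hQ : coeffField h = ⊥) :
    ∃ g g' : ℚ, g ≠ 0 ∧ g' ≠ 0 ∧
      (∀ m a, InC m a → ∃ n n' : ℤ, plusCuspDiff h m a = n * g ∧
        stabEisCuspDiff 15 β m a = n' * g' ∧ (n : ZMod 2) = (n' : ZMod 2)) ∧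
      (∃ m a, InC m a ∧ ∃ n : ℤ, plusCuspDiff h m a = n * g ∧ Odd n) := by
  obtain ⟨s, hs, hcusp⟩ := ratPlusSymbol_sub_zero_eq_descent h hf hQ
  have hs0 : (s : ℚ) ≠ 0 := by rcases hs with rfl | rfl <;> norm_num
  -- the common computation at a dyadic cusp `a/2^m`, `a` odd
  have key : ∀ (m : ℕ) (a : ℤ), Odd a →
      ∃ w z : ℤ, plusCuspDiff h m a = w * (s : ℚ) ∧ stabEisCuspDiff 15 β m a = (w + 2 * z : ℤ) * (8 / 15 : ℚ) ∧
        2 * w = (descent ((2 ^ m : ℕ) : ℤ) (15 * Int.gcdB ((2 ^ m : ℕ) : ℤ) (a * 15))).1 -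
          (descent ((2 ^ m : ℕ) : ℤ) (15 * Int.gcdB ((2 ^ m : ℕ) : ℤ) 15)).1 := by
    intro m a ha
    set c : ℤ := ((2 ^ m : ℕ) : ℤ) with hc
    have hc0 : c ≠ 0 := by rw [hc]; positivity
    -- Bézout data of `a` and of `1`
    set xa : ℤ := Int.gcdA c (a * 15) with hxa
    set ya : ℤ := Int.gcdB c (a * 15) with hya
    set x1 : ℤ := Int.gcdA c 15 with hx1
    set y1 : ℤ := Int.gcdB c 15 with hy1
    have hga : c * xa + a * 15 * ya = 1 := by
      have e := Int.gcd_eq_gcd_ab c (a * 15)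
      have e1 : Int.gcd c (a * 15) = 1 := by rw [hc]; exact_mod_cast int_gcd_two_pow_eq_one (N := 15) (by decide) ha m
      rw [e1] at e; push_cast at e; linear_combination -e
    have hg1 : c * x1 + 1 * 15 * y1 = 1 := by
      have e := Int.gcd_eq_gcd_ab c 15
      have e1 : Int.gcd c 15 = 1 := by
        have e' := int_gcd_two_pow_eq_one (N := 15) (by decide) odd_one m
        rw [one_mul] at e'; rw [hc]; exact_mod_cast e'
      rw [e1] at e; push_cast at e; linear_combination -e
    obtain ⟨ka, ha00, ha01, ha10, ha11, haS00, haS01, haS10, haS11⟩ := exists_sl_of_bezout a xa c ya hga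
    obtain ⟨k1, h100, h101, h110, h111, h1S00, h1S01, h1S10, h1S11⟩ := exists_sl_of_bezout 1 x1 c y1 hg1
    -- the curve side: `[a/c]⁺ = [0]⁺ + s·n₁/2`
    have hua := hcusp a (-xa) c (15 * ya) (by linear_combination hga) hc0 ⟨ya, by ring⟩
    have hu1 := hcusp 1 (-x1) c (15 * y1) (by linear_combination hg1) hc0 ⟨y1, by ring⟩
    -- parity: both `E₁`-coordinates have the parity of `[c ≡ ±2 (mod 5)]`
    have hpa := descent_fst_parity_of_fifteen_dvd (c := c) (d := 15 * ya) ⟨xa, a, by linear_combination hga⟩ ⟨ya, rfl⟩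
    have hp1 := descent_fst_parity_of_fifteen_dvd (c := c) (d := 15 * y1) ⟨x1, 1, by linear_combination hg1⟩ ⟨y1, rfl⟩
    obtain ⟨w, hw⟩ : (2 : ℤ) ∣ (descent c (15 * ya)).1 - (descent c (15 * y1)).1 := by
      have e := dvd_sub hpa hp1
      have e' : (descent c (15 * ya)).1 - (if c % 5 = 2 ∨ c % 5 = 3 then 1 else 0) -
          ((descent c (15 * y1)).1 - (if c % 5 = 2 ∨ c % 5 = 3 then 1 else 0)) =
          (descent c (15 * ya)).1 - (descent c (15 * y1)).1 := by ring
      rwa [e'] at e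
    have hw' : (((descent c (15 * ya)).1 : ℚ)) - ((descent c (15 * y1)).1 : ℚ) = 2 * (w : ℚ) := by
      exact_mod_cast hw
    -- the Eisenstein side: the period law for the pair `(k_a, k_1)`
    obtain ⟨z, hz⟩ := law_pair (k := ka) (k' := k1) (by rw [ha10, h110]) (by rw [ha11]; exact ⟨_, rfl⟩)
      (by rw [h111]; exact ⟨_, rfl⟩)
    rw [ha10, ha11, h110, h111] at hz
    have hv : stabEisCuspDiff 15 β m a = eisPeriod15SL (ka * S⁻¹) - eisPeriod15SL (k1 * S⁻¹) := by
      rw [stabEisCuspDiff_eq, stabEisensteinPeriod_fifteen_eq β h3 h5, stabEisensteinPeriod_fifteen_eq β h3 h5,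
        eisPeriod15SL, eisPeriod15SL, haS00, haS01, haS10, haS11, h1S00, h1S01, h1S10, h1S11]
      simp only [Nat.cast_ofNat, one_mul, ← hc, ← hxa, ← hya, ← hx1, ← hy1]
    refine ⟨w, z, ?_, ?_, by linear_combination -hw⟩
    · -- `u = s·(n₁ − n₁')/2 = w·s`
      unfold plusCuspDiff
      have e1 : ((a : ℚ) / (2 ^ m : ℕ)) = (a : ℚ) / (c : ℚ) := by rw [hc]; push_cast; ring
      have e2 : ((1 : ℚ) / (2 ^ m : ℕ)) = ((1 : ℤ) : ℚ) / (c : ℚ) := by rw [hc]; push_cast; ring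
      rw [e1, e2, hua, hu1]
      push_cast
      linear_combination ((s : ℚ) / 2) * hw'
    · rw [hv]
      push_cast at hz ⊢
      linear_combination (4 / 15 : ℚ) * hz + (4 / 15 : ℚ) * hw'
  refine ⟨s, 8 / 15, hs0, by norm_num, fun m a hma ↦ ?_, ⟨3, 5, ⟨le_rfl, by decide, by norm_num, by norm_num⟩, ?_⟩⟩
  · have ha : Odd a := by
      obtain ⟨-, h4, -, -⟩ := hma
      exact Int.odd_iff.mpr (by omega)
    obtain ⟨w, z, hu, hv, -⟩ := key m a ha
    exact ⟨w, w + 2 * z, hu, hv, by push_cast; rw [show (2 : ZMod 2) = 0 from rfl]; ring⟩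
  · obtain ⟨w, z, hu, -, hw⟩ := key 3 5 (by decide)
    refine ⟨w, hu, ?_⟩
    have d5 : (descent ((2 ^ 3 : ℕ) : ℤ) (15 * Int.gcdB ((2 ^ 3 : ℕ) : ℤ) (5 * 15))).1 = 1 := by decide +kernel
    have d1 : (descent ((2 ^ 3 : ℕ) : ℤ) (15 * Int.gcdB ((2 ^ 3 : ℕ) : ℤ) 15)).1 = -1 := by decide +kernel
    rw [d5, d1] at hw
    exact ⟨0, by omega⟩

/-- **(★-SymbC) FOR EVERY ELLIPTIC CURVE OF CONDUCTOR 15** (`∃ β` form = the body of the registered research stub `StarSymbC`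
of line `star`, habitat hypotheses not even needed): if `N_W = 15` and `f` is a newform of `W` at any level `N`, then `N = 15`
(Atkin–Lehner / the squarefree case of Carayol's theorem), `f` has rational coefficients, and `sameOnC_fifteen` applies with
the admissible datum `β = (3,1)`. [cite: AtkinLehner1970, Thm. 3] [cite: MazurTateTeitelbaum1986Invent, §I.10 (10.1)]
[cite: Stevens1982, §2.4–2.5 (PDF pp. 35–38)] -/
theorem starSymbC_of_conductorNorm_eq_fifteen (W : WeierstrassCurve ℚ) [W.IsElliptic]
    (hN : W.conductorNorm ℤ = 15) ⦃N : ℕ⦄ [NeZero N] (f : CuspForm (Gamma0 N) 2) (hW : IsNewformOf W f) :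
    ∃ β : ℕ → ℕ, IsAdmissibleStabData (W.conductorNorm ℤ) β ∧
      ∃ g g' : ℚ, g ≠ 0 ∧ g' ≠ 0 ∧
        (∀ m a, InC m a → ∃ n n' : ℤ, plusCuspDiff f m a = n * g ∧
          stabEisCuspDiff (W.conductorNorm ℤ) β m a = n' * g' ∧ (n : ZMod 2) = (n' : ZMod 2)) ∧
        (∃ m a, InC m a ∧ ∃ n : ℤ, plusCuspDiff f m a = n * g ∧ Odd n) := by
  have hsq : Squarefree (W.conductorNorm ℤ) := by
    rw [hN, show (15 : ℕ) = 3 * 5 by norm_num, Nat.squarefree_mul (by norm_num)]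
    exact ⟨Nat.prime_three.prime.squarefree, Nat.prime_five.prime.squarefree⟩
  have h15 : N = 15 := (hW.level_eq_conductorNorm_of_squarefree hsq).trans hN
  subst h15
  rw [hN]
  exact ⟨fun ℓ ↦ if ℓ = 3 then 3 else 1, isAdmissibleStabData_fifteen _ (by simp) (by simp),
    sameOnC_fifteen _ (by simp) (by simp) f hW.1 hW.coeffField_eq_bot⟩

end Summit.BirchSwinnertonDyer.BirchSwinnertonDyer.Theorems.DepletionAtTwo

end
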